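import Literature.Probability.RandomPlanarGeometry.HexSAWLattice
import HarnessLib

/-!
# Hexagon surgery for self-avoiding walks on the honeycomb lattice

Topic `Literature/Probability/RandomPlanarGeometry` (self-avoiding walks on the hexagonal lattice `ℍ`, in the
coordinate model `hvGraph` on `HV = ℤ × ℤ × Bool` of `HexSAWLattice.lean` — THE WALK MODEL OF THIS FILE AND OF
EVERY FILE IMPORTING IT: `S_N(ℍ) := HV.sawFin hvOrigin N`, `#S_N(ℍ) = hexSawCount N` by `hexSawCount_eq_card`).
Lane «pcv-sawmu», bet A2 «HEX-RATIO-2» (`c_{N+2}(ℍ)/c_N(ℍ) → 2 + √2`), piece H-BASE.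

Source of the method: N. Madras, G. Slade, *The Self-Avoiding Walk* (1993), §7.3, proof of Theorem 7.3.2,
pp. 244–247 («changing an occurrence of `U` into an occurrence of `V`» and counting the allowed pairs in two
ways, eqs. (7.3.5)–(7.3.7)), and Theorem 7.3.4(a) p. 248 (Kesten's `c_{N+2}/c_N → μ²` on `ℤ^d`); H. Kesten,
*On the number of self-avoiding walks*, J. Math. Phys. 4 (1963) 960–969. On `ℍ` the cube surgery of `ℤ^d` is
replaced by the **hexagon surgery**: two consecutive edges `ω_m ω_{m+1}`, `ω_{m+1} ω_{m+2}` of a walk lie on a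
hexagon `H`; if the other three vertices `x, y, z` of `H` are unvisited (an *insertion slot*), the two edges are
replaced by the four complementary edges `ω_m x, x y, y z, z ω_{m+2}` (`+2` steps, `ω_{m+1}` leaves the walk);
conversely four consecutive edges `ω_m … ω_{m+4}` together with an unvisited common neighbour `v` of `ω_m` and
`ω_{m+4}` (a *deletion site*: the five walk vertices and `v` are then the six vertices of one hexagon) are
replaced by the two edges `ω_m v, v ω_{m+4}`. This is the `𝕋`-file `SAWTriangularDetourSurgery.lean`
(`triIns`/`triDel`, one step) transposed to `ℍ` (two steps); no planar geometry beyond adjacency is used.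

## Contents (namespace `Literature.Probability.RandomPlanarGeometry.SAW.HV`, all PROVED, every `N`)

* Walks of `S_N(ℍ) = sawFin hvOrigin N` by vertex access `ω.getD j hvOrigin`: `length_of_mem_sawFin`,
  `nodup_of_mem_sawFin`, `adj_getD_of_mem_sawFin`, `getD_zero_of_mem_sawFin`, `getD_injOn_of_mem_sawFin`,
  `mem_sawFin_of`; `hexNb u` (the three neighbours as a finset), `hexChain3 u` (3-step neighbour chains).
* `hexSharp ω : Finset (ℕ × HV)` — the deletion sites `(m, v)` (`ω_m ~ v ~ ω_{m+4}`, `v ∉ ω`);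
  `hexSlots ω : Finset (ℕ × HV × HV × HV)` — the insertion slots `(m, x, y, z)`
  (`ω_m ~ x ~ y ~ z ~ ω_{m+2}`, `x, y, z ∉ ω`, `x ≠ z`); `hexIns m x y z ω` / `hexDel m v ω`.
* Surgery laws: `hexIns_mem_sawFin`, `mem_hexSharp_hexIns`, `hexDel_mem_sawFin`, `mem_hexSlots_hexDel`,
  `hexDel_hexIns`, `hexIns_hexDel`; the pair bijection **`sum_hexSlotPairs_eq_sum_hexSharpPairs`**
  (slot pairs of `S_N` ≅ deletion-site pairs of `S_{N+2}`), `sum_hexSlotPairs`, `sum_hexSharpPairs`.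
* Bookkeeping (inexact, with absolute constants): `one_le_card_hexSharp_hexIns` (`1 ≤ J'`),
  `card_hexSharp_le_hexIns` (`J ≤ J' + 24`), `card_hexSharp_hexIns_le` (`J' ≤ J + 24`),
  `card_hexSlots_le_hexIns` (`I ≤ I' + 324`), `card_hexSlots_le` (`I ≤ 27 N`), `card_hexSharp_le` (`J ≤ 3 N`);
  `mem_hexIns_of_mem` (vertices other than `ω_{m+1}` survive). Counting helpers are `private`.
* Faces of the bet (statement shapes): `DetourDensityHex` (density of deletion sites, exponential form — the
  entropy input, proved in the lane's K1′-ℍ file) and `KestenIneqHex` (hypothesis `hiii` of the tree's two-step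
  Kesten lemma `Zd.tendsto_ratio_of_kesten` for `a = hexSawCount`).
-/

noncomputable section

open Finset Filter Topology
open Literature.Probability.LatticeModels Literature.Probability.Percolation SimpleGraph

namespace Literature.Probability.RandomPlanarGeometry.SAW.HV

/-- A direct `DecidableEq` instance for `HV = ℤ × ℤ × Bool` (shortens instance search for the nested product
types of slots below). [folklore] -/
instance instDecidableEqHV : DecidableEq HV := inferInstanceAs (DecidableEq (ℤ × ℤ × Bool))

/-! ### The walks of `S_N(ℍ)`; vertex access by `List.getD` -/

/-- Membership in a list by vertex access. [folklore] -/
private theorem mem_iff_exists_getD {l : List HV} {a : HV} : a ∈ l ↔ ∃ i, i < l.length ∧ l.getD i hvOrigin = a := by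
  rw [List.mem_iff_getElem]
  constructor
  · rintro ⟨i, hi, rfl⟩
    exact ⟨i, hi, (List.getElem_eq_getD hvOrigin).symm⟩
  · rintro ⟨i, hi, rfl⟩
    exact ⟨i, hi, List.getElem_eq_getD hvOrigin⟩

/-- A vertex read off by `getD` inside the list is a member. [folklore] -/
private theorem getD_mem_of_lt' {ω : List HV} {j : ℕ} (hj : j < ω.length) : ω.getD j hvOrigin ∈ ω := by
  rw [← List.getElem_eq_getD (h := hj)]
  exact List.getElem_mem hj

section MemSawFin

variable {N : ℕ} {ω : List HV}

/-- Length of a walk of `S_N(ℍ)`. [cite: MadrasSlade1993, §1.1] -/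
theorem length_of_mem_sawFin (h : ω ∈ sawFin hvOrigin N) : ω.length = N + 1 := (mem_sawFin_iff.1 h).2.2.1

/-- A walk of `S_N(ℍ)` is self-avoiding. [cite: MadrasSlade1993, §1.1] -/
theorem nodup_of_mem_sawFin (h : ω ∈ sawFin hvOrigin N) : ω.Nodup := (mem_sawFin_iff.1 h).2.2.2

/-- A walk of `S_N(ℍ)` is a chain of adjacent vertices. [cite: MadrasSlade1993, §1.1] -/
theorem isChain_of_mem_sawFin (h : ω ∈ sawFin hvOrigin N) : ω.IsChain hvGraph.Adj := (mem_sawFin_iff.1 h).1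

/-- Consecutive vertices of a walk of `S_N(ℍ)` are adjacent. [cite: MadrasSlade1993, §1.1] -/
theorem adj_getD_of_mem_sawFin (h : ω ∈ sawFin hvOrigin N) {i : ℕ} (hi : i + 1 ≤ N) :
    hvGraph.Adj (ω.getD i hvOrigin) (ω.getD (i + 1) hvOrigin) := by
  have hl := length_of_mem_sawFin h
  have hc := List.isChain_iff_getElem.1 (mem_sawFin_iff.1 h).1 i (by omega)
  rwa [List.getElem_eq_getD hvOrigin, List.getElem_eq_getD hvOrigin] at hc

/-- A walk of `S_N(ℍ)` starts at the origin. [cite: MadrasSlade1993, §1.1] -/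
theorem getD_zero_of_mem_sawFin (h : ω ∈ sawFin hvOrigin N) : ω.getD 0 hvOrigin = hvOrigin := by
  have hh := (mem_sawFin_iff.1 h).2.1
  rw [List.head?_eq_getElem?] at hh
  rw [List.getD_eq_getElem?_getD, hh, Option.getD_some]

/-- Vertex access is injective on a walk of `S_N(ℍ)`. [cite: MadrasSlade1993, §1.1] -/
theorem getD_injOn_of_mem_sawFin (h : ω ∈ sawFin hvOrigin N) {i j : ℕ} (hi : i < N + 1) (hj : j < N + 1)
    (e : ω.getD i hvOrigin = ω.getD j hvOrigin) : i = j := by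
  have hl := length_of_mem_sawFin h
  have hn := nodup_of_mem_sawFin h
  rw [← List.getElem_eq_getD (h := by omega), ← List.getElem_eq_getD (h := by omega)] at e
  exact (List.Nodup.getElem_inj_iff hn).1 e

/-- A constructor for membership in `S_N(ℍ)` by vertex access. [cite: MadrasSlade1993, §1.1] -/
theorem mem_sawFin_of (hlen : ω.length = N + 1) (h0 : ω.getD 0 hvOrigin = hvOrigin)
    (hchain : ∀ i, i + 1 ≤ N → hvGraph.Adj (ω.getD i hvOrigin) (ω.getD (i + 1) hvOrigin))
    (hnodup : ω.Nodup) : ω ∈ sawFin hvOrigin N := by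
  refine mem_sawFin_iff.2 ⟨?_, ?_, hlen, hnodup⟩
  · refine List.isChain_iff_getElem.2 fun i hi => ?_
    rw [List.getElem_eq_getD hvOrigin, List.getElem_eq_getD hvOrigin]
    exact hchain i (by omega)
  · rw [List.head?_eq_getElem?, List.getElem?_eq_getElem (show 0 < ω.length by omega),
      List.getElem_eq_getD hvOrigin, h0]

end MemSawFin

/-! ### Neighbour finsets -/

/-- The three neighbours of a vertex of `ℍ`, as a finset. [folklore] -/
def hexNb (u : HV) : Finset HV := (nbrs u).toFinset

/-- Membership in `hexNb` is adjacency. [folklore] -/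
private theorem mem_hexNb {u v : HV} : v ∈ hexNb u ↔ hvGraph.Adj u v := by
  rw [hexNb, List.mem_toFinset, hvGraph_adj_iff_mem_nbrs]

/-- A vertex of `ℍ` has at most three neighbours. [folklore] -/
private theorem card_hexNb_le (u : HV) : #(hexNb u) ≤ 3 := by
  refine (List.toFinset_card_le _).trans ?_
  obtain ⟨a, b, c⟩ := u
  cases c <;> simp [nbrs]

/-- The 3-step neighbour chains `(x, y, z)` from `u`: `u ~ x ~ y ~ z`. [folklore] -/
def hexChain3 (u : HV) : Finset (HV × HV × HV) :=
  (hexNb u).biUnion fun x => (hexNb x).biUnion fun y => (hexNb y).image fun z => (x, y, z)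

/-- Membership in `hexChain3`. [folklore] -/
private theorem mem_hexChain3 {u x y z : HV} :
    (x, y, z) ∈ hexChain3 u ↔ hvGraph.Adj u x ∧ hvGraph.Adj x y ∧ hvGraph.Adj y z := by
  simp only [hexChain3, mem_biUnion, mem_image, Prod.mk.injEq, mem_hexNb]
  constructor
  · rintro ⟨x', hx', y', hy', z', hz', rfl, rfl, rfl⟩
    exact ⟨hx', hy', hz'⟩
  · rintro ⟨hx, hy, hz⟩
    exact ⟨x, hx, y, hy, z, hz, rfl, rfl, rfl⟩

/-- There are at most `27` such chains. [folklore] -/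
private theorem card_hexChain3_le (u : HV) : #(hexChain3 u) ≤ 27 := by
  unfold hexChain3
  calc #((hexNb u).biUnion fun x => (hexNb x).biUnion fun y => (hexNb y).image fun z => (x, y, z))
      ≤ ∑ x ∈ hexNb u, #((hexNb x).biUnion fun y => (hexNb y).image fun z => (x, y, z)) := card_biUnion_le
    _ ≤ ∑ x ∈ hexNb u, 9 := by
        refine sum_le_sum fun x _ => card_biUnion_le.trans ?_
        calc ∑ y ∈ hexNb x, #((hexNb y).image fun z => (x, y, z)) ≤ ∑ y ∈ hexNb x, 3 :=
              sum_le_sum fun y _ => card_image_le.trans (card_hexNb_le y)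
          _ ≤ 9 := by rw [sum_const, smul_eq_mul]; have := card_hexNb_le x; omega
    _ ≤ 27 := by rw [sum_const, smul_eq_mul]; have := card_hexNb_le u; omega

/-! ### Deletion sites, insertion slots, insertion and deletion -/

/-- The **deletion sites** of a walk: pairs `(m, v)` with `ω_m ~ v ~ ω_{m+4}` and `v` unvisited (then
`ω_m, …, ω_{m+4}, v` are the six vertices of a hexagon, four of whose edges the walk traverses; they can be
replaced by the two edges through `v`). `J(ω) := #(hexSharp ω)`.
[cite: MadrasSlade1993, §7.3 (proof of Theorem 7.3.2), p. 244 (the pattern `V`)] -/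
def hexSharp (ω : List HV) : Finset (ℕ × HV) :=
  ((range (ω.length - 4)).biUnion fun m => (hexNb (ω.getD m hvOrigin)).image fun v => (m, v)).filter
    fun p => hvGraph.Adj p.2 (ω.getD (p.1 + 4) hvOrigin) ∧ p.2 ∉ ω

/-- The **insertion slots** of a walk: `(m, x, y, z)` with `ω_m ~ x ~ y ~ z ~ ω_{m+2}`, `x, y, z` unvisited and
`x ≠ z` (then `ω_m, ω_{m+1}, ω_{m+2}, z, y, x` are the six vertices of a hexagon, two of whose edges the walk
traverses; they can be replaced by the four edges through `x, y, z`). `I(ω) := #(hexSlots ω)`.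
[cite: MadrasSlade1993, §7.3 (proof of Theorem 7.3.2), p. 244 (the pattern `U`)] -/
def hexSlots (ω : List HV) : Finset (ℕ × HV × HV × HV) :=
  ((range (ω.length - 2)).biUnion fun m => (hexChain3 (ω.getD m hvOrigin)).image fun c => (m, c)).filter
    fun s => hvGraph.Adj s.2.2.2 (ω.getD (s.1 + 2) hvOrigin) ∧ s.2.1 ∉ ω ∧ s.2.2.1 ∉ ω ∧ s.2.2.2 ∉ ω ∧
      s.2.1 ≠ s.2.2.2

/-- **Hexagon insertion**: replace the vertex `ω_{m+1}` by the three vertices `x, y, z`.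
[cite: MadrasSlade1993, §7.3 (proof of Theorem 7.3.2)] -/
def hexIns (m : ℕ) (x y z : HV) (ω : List HV) : List HV := ω.take (m + 1) ++ x :: y :: z :: ω.drop (m + 2)

/-- **Hexagon deletion**: replace the three vertices `ω_{m+1}, ω_{m+2}, ω_{m+3}` by the vertex `v`.
[cite: MadrasSlade1993, §7.3 (proof of Theorem 7.3.2)] -/
def hexDel (m : ℕ) (v : HV) (ω : List HV) : List HV := ω.take (m + 1) ++ v :: ω.drop (m + 4)

section Access

variable {ω : List HV} {m j : ℕ} {x y z v a : HV}

/-- Membership in `hexSharp`. [cite: MadrasSlade1993, §7.3] -/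
theorem mem_hexSharp : (m, v) ∈ hexSharp ω ↔ m + 4 < ω.length ∧ hvGraph.Adj (ω.getD m hvOrigin) v ∧
    hvGraph.Adj v (ω.getD (m + 4) hvOrigin) ∧ v ∉ ω := by
  simp only [hexSharp, mem_filter, mem_biUnion, mem_range, mem_image, Prod.mk.injEq, mem_hexNb]
  constructor
  · rintro ⟨⟨m', hm', v', hv', rfl, rfl⟩, h2, h3⟩
    exact ⟨by omega, hv', h2, h3⟩
  · rintro ⟨h1, h2, h3, h4⟩
    exact ⟨⟨m, by omega, v, h2, rfl, rfl⟩, h3, h4⟩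

/-- Membership in `hexSlots`. [cite: MadrasSlade1993, §7.3] -/
theorem mem_hexSlots : (m, x, y, z) ∈ hexSlots ω ↔ m + 2 < ω.length ∧ hvGraph.Adj (ω.getD m hvOrigin) x ∧
    hvGraph.Adj x y ∧ hvGraph.Adj y z ∧ hvGraph.Adj z (ω.getD (m + 2) hvOrigin) ∧
    x ∉ ω ∧ y ∉ ω ∧ z ∉ ω ∧ x ≠ z := by
  rw [hexSlots, mem_filter]
  simp only [mem_biUnion, mem_range, mem_image, Prod.mk.injEq]
  constructor
  · rintro ⟨⟨m', hm', c, hc, rfl, rfl⟩, h2, h3, h4, h5, h6⟩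
    obtain ⟨hx, hy, hz⟩ := mem_hexChain3.1 hc
    exact ⟨by omega, hx, hy, hz, h2, h3, h4, h5, h6⟩
  · rintro ⟨h1, hx, hy, hz, h2, h3, h4, h5, h6⟩
    exact ⟨⟨m, by omega, (x, y, z), mem_hexChain3.2 ⟨hx, hy, hz⟩, rfl, rfl⟩, h2, h3, h4, h5, h6⟩

/-- `J(ω) ≤ 3(|ω| − 4)`. [cite: MadrasSlade1993, §7.3] -/
theorem card_hexSharp_le : #(hexSharp ω) ≤ 3 * (ω.length - 4) := by
  refine (card_filter_le _ _).trans (card_biUnion_le.trans ?_)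
  calc ∑ m ∈ range (ω.length - 4), #((hexNb (ω.getD m hvOrigin)).image fun v => (m, v))
      ≤ ∑ _m ∈ range (ω.length - 4), 3 :=
        sum_le_sum fun m _ => card_image_le.trans (card_hexNb_le _)
    _ = 3 * (ω.length - 4) := by rw [sum_const, card_range, smul_eq_mul, mul_comm]

/-- `I(ω) ≤ 27(|ω| − 2)`. [cite: MadrasSlade1993, §7.3] -/
theorem card_hexSlots_le : #(hexSlots ω) ≤ 27 * (ω.length - 2) := by
  refine (card_filter_le _ _).trans (card_biUnion_le.trans ?_)
  calc ∑ m ∈ range (ω.length - 2), #((hexChain3 (ω.getD m hvOrigin)).image fun c => (m, c))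
      ≤ ∑ _m ∈ range (ω.length - 2), 27 :=
        sum_le_sum fun m _ => card_image_le.trans (card_hexChain3_le _)
    _ = 27 * (ω.length - 2) := by rw [sum_const, card_range, smul_eq_mul, mul_comm]

/-- Length of the prefix kept by the surgeries. [folklore] -/
private theorem length_take_succ (hm : m + 1 ≤ ω.length) : (ω.take (m + 1)).length = m + 1 := by
  rw [List.length_take]; omega

/-- Vertices of `hexIns m x y z ω` up to position `m`. [cite: MadrasSlade1993, §7.3 (proof of Theorem 7.3.2)] -/
theorem getD_hexIns_of_le (hm : m + 1 ≤ ω.length) (hj : j ≤ m) :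
    (hexIns m x y z ω).getD j hvOrigin = ω.getD j hvOrigin := by
  have hlt : j < (ω.take (m + 1)).length := by rw [length_take_succ hm]; omega
  rw [hexIns, List.getD_eq_getElem?_getD, List.getD_eq_getElem?_getD, List.getElem?_append_left hlt,
    List.getElem?_take, if_pos (by omega)]

/-- Positions after the kept prefix of `hexIns`. [folklore] -/
private theorem getElem?_hexIns_add (hm : m + 1 ≤ ω.length) (k : ℕ) :
    (hexIns m x y z ω)[m + 1 + k]? = (x :: y :: z :: ω.drop (m + 2))[k]? := by
  rw [hexIns, List.getElem?_append_right (by rw [length_take_succ hm]; omega), length_take_succ hm,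
    show m + 1 + k - (m + 1) = k by omega]

/-- The first inserted vertex. [cite: MadrasSlade1993, §7.3 (proof of Theorem 7.3.2)] -/
theorem getD_hexIns_one (hm : m + 1 ≤ ω.length) : (hexIns m x y z ω).getD (m + 1) hvOrigin = x := by
  rw [List.getD_eq_getElem?_getD, show m + 1 = m + 1 + 0 from rfl, getElem?_hexIns_add hm]
  rfl

/-- The second inserted vertex. [cite: MadrasSlade1993, §7.3 (proof of Theorem 7.3.2)] -/
theorem getD_hexIns_two (hm : m + 1 ≤ ω.length) : (hexIns m x y z ω).getD (m + 2) hvOrigin = y := by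
  rw [List.getD_eq_getElem?_getD, show m + 2 = m + 1 + 1 from rfl, getElem?_hexIns_add hm]
  rfl

/-- The third inserted vertex. [cite: MadrasSlade1993, §7.3 (proof of Theorem 7.3.2)] -/
theorem getD_hexIns_three (hm : m + 1 ≤ ω.length) : (hexIns m x y z ω).getD (m + 3) hvOrigin = z := by
  rw [List.getD_eq_getElem?_getD, show m + 3 = m + 1 + 2 from rfl, getElem?_hexIns_add hm]
  rfl

/-- Vertices of `hexIns m x y z ω` after the inserted ones. [cite: MadrasSlade1993, §7.3 (proof of Theorem 7.3.2)] -/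
theorem getD_hexIns_of_ge (hm : m + 1 ≤ ω.length) (hj : m + 4 ≤ j) :
    (hexIns m x y z ω).getD j hvOrigin = ω.getD (j - 2) hvOrigin := by
  obtain ⟨k, rfl⟩ : ∃ k, j = m + 1 + (k + 3) := ⟨j - m - 4, by omega⟩
  rw [List.getD_eq_getElem?_getD, List.getD_eq_getElem?_getD, getElem?_hexIns_add hm,
    List.getElem?_cons_succ, List.getElem?_cons_succ, List.getElem?_cons_succ, List.getElem?_drop,
    show m + 2 + k = m + 1 + (k + 3) - 2 by omega]

/-- Length after insertion. [cite: MadrasSlade1993, §7.3 (proof of Theorem 7.3.2)] -/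
theorem length_hexIns (hm : m + 2 ≤ ω.length) : (hexIns m x y z ω).length = ω.length + 2 := by
  simp only [hexIns, List.length_append, List.length_cons, List.length_take, List.length_drop]
  omega

/-- Members after insertion. [cite: MadrasSlade1993, §7.3 (proof of Theorem 7.3.2)] -/
theorem mem_hexIns (h : a ∈ hexIns m x y z ω) : a = x ∨ a = y ∨ a = z ∨ a ∈ ω := by
  simp only [hexIns, List.mem_append, List.mem_cons] at h
  rcases h with h | h | h | h | h
  · exact Or.inr (Or.inr (Or.inr (List.mem_of_mem_take h)))
  · exact Or.inl h
  · exact Or.inr (Or.inl h)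
  · exact Or.inr (Or.inr (Or.inl h))
  · exact Or.inr (Or.inr (Or.inr (List.mem_of_mem_drop h)))

/-- Where a vertex of `hexIns m x y z ω` sits, by position. [folklore] -/
private theorem getD_hexIns_cases (hm : m + 2 ≤ ω.length) {i : ℕ} (_hi : i < ω.length + 2) :
    (i ≤ m ∧ (hexIns m x y z ω).getD i hvOrigin = ω.getD i hvOrigin) ∨
    (i = m + 1 ∧ (hexIns m x y z ω).getD i hvOrigin = x) ∨
    (i = m + 2 ∧ (hexIns m x y z ω).getD i hvOrigin = y) ∨
    (i = m + 3 ∧ (hexIns m x y z ω).getD i hvOrigin = z) ∨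
    (m + 4 ≤ i ∧ (hexIns m x y z ω).getD i hvOrigin = ω.getD (i - 2) hvOrigin) := by
  rcases Nat.lt_or_ge i (m + 1) with h1 | h1
  · exact Or.inl ⟨by omega, getD_hexIns_of_le (by omega) (by omega)⟩
  rcases Nat.lt_or_ge i (m + 2) with h2 | h2
  · obtain rfl : i = m + 1 := by omega
    exact Or.inr (Or.inl ⟨rfl, getD_hexIns_one (by omega)⟩)
  rcases Nat.lt_or_ge i (m + 3) with h3 | h3
  · obtain rfl : i = m + 2 := by omega
    exact Or.inr (Or.inr (Or.inl ⟨rfl, getD_hexIns_two (by omega)⟩))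
  rcases Nat.lt_or_ge i (m + 4) with h4 | h4
  · obtain rfl : i = m + 3 := by omega
    exact Or.inr (Or.inr (Or.inr (Or.inl ⟨rfl, getD_hexIns_three (by omega)⟩)))
  · exact Or.inr (Or.inr (Or.inr (Or.inr ⟨h4, getD_hexIns_of_ge (by omega) h4⟩)))

/-- Vertices of `hexDel m v ω` up to position `m`. [cite: MadrasSlade1993, §7.3 (proof of Theorem 7.3.2)] -/
theorem getD_hexDel_of_le (hm : m + 1 ≤ ω.length) (hj : j ≤ m) :
    (hexDel m v ω).getD j hvOrigin = ω.getD j hvOrigin := by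
  have hlt : j < (ω.take (m + 1)).length := by rw [length_take_succ hm]; omega
  rw [hexDel, List.getD_eq_getElem?_getD, List.getD_eq_getElem?_getD, List.getElem?_append_left hlt,
    List.getElem?_take, if_pos (by omega)]

/-- Positions after the kept prefix of `hexDel`. [folklore] -/
private theorem getElem?_hexDel_add (hm : m + 1 ≤ ω.length) (k : ℕ) :
    (hexDel m v ω)[m + 1 + k]? = (v :: ω.drop (m + 4))[k]? := by
  rw [hexDel, List.getElem?_append_right (by rw [length_take_succ hm]; omega), length_take_succ hm,
    show m + 1 + k - (m + 1) = k by omega]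

/-- The vertex put in by the deletion. [cite: MadrasSlade1993, §7.3 (proof of Theorem 7.3.2)] -/
theorem getD_hexDel_one (hm : m + 1 ≤ ω.length) : (hexDel m v ω).getD (m + 1) hvOrigin = v := by
  rw [List.getD_eq_getElem?_getD, show m + 1 = m + 1 + 0 from rfl, getElem?_hexDel_add hm]
  rfl

/-- Vertices of `hexDel m v ω` after position `m + 1`. [cite: MadrasSlade1993, §7.3 (proof of Theorem 7.3.2)] -/
theorem getD_hexDel_of_ge (hm : m + 1 ≤ ω.length) (hj : m + 2 ≤ j) :
    (hexDel m v ω).getD j hvOrigin = ω.getD (j + 2) hvOrigin := by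
  obtain ⟨k, rfl⟩ : ∃ k, j = m + 1 + (k + 1) := ⟨j - m - 2, by omega⟩
  rw [List.getD_eq_getElem?_getD, List.getD_eq_getElem?_getD, getElem?_hexDel_add hm,
    List.getElem?_cons_succ, List.getElem?_drop, show m + 4 + k = m + 1 + (k + 1) + 2 by omega]

/-- Length after deletion. [cite: MadrasSlade1993, §7.3 (proof of Theorem 7.3.2)] -/
theorem length_hexDel (hm : m + 4 ≤ ω.length) : (hexDel m v ω).length = ω.length - 2 := by
  simp only [hexDel, List.length_append, List.length_cons, List.length_take, List.length_drop]
  omega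

/-- Members after deletion. [cite: MadrasSlade1993, §7.3 (proof of Theorem 7.3.2)] -/
theorem mem_hexDel (h : a ∈ hexDel m v ω) : a = v ∨ a ∈ ω := by
  simp only [hexDel, List.mem_append, List.mem_cons] at h
  rcases h with h | h | h
  · exact Or.inr (List.mem_of_mem_take h)
  · exact Or.inl h
  · exact Or.inr (List.mem_of_mem_drop h)

/-- Where a vertex of `hexDel m v ω` sits, by position. [folklore] -/
private theorem getD_hexDel_cases (hm : m + 4 ≤ ω.length) {i : ℕ} (_hi : i < ω.length - 2) :
    (i ≤ m ∧ (hexDel m v ω).getD i hvOrigin = ω.getD i hvOrigin) ∨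
    (i = m + 1 ∧ (hexDel m v ω).getD i hvOrigin = v) ∨
    (m + 2 ≤ i ∧ (hexDel m v ω).getD i hvOrigin = ω.getD (i + 2) hvOrigin) := by
  rcases Nat.lt_or_ge i (m + 1) with h1 | h1
  · exact Or.inl ⟨by omega, getD_hexDel_of_le (by omega) (by omega)⟩
  rcases Nat.lt_or_ge i (m + 2) with h2 | h2
  · obtain rfl : i = m + 1 := by omega
    exact Or.inr (Or.inl ⟨rfl, getD_hexDel_one (by omega)⟩)
  · exact Or.inr (Or.inr ⟨h2, getD_hexDel_of_ge (by omega) h2⟩)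

/-- Deleting the inserted vertices. [cite: MadrasSlade1993, §7.3 (proof of Theorem 7.3.2)] -/
theorem hexDel_hexIns (hm : m + 2 ≤ ω.length) : hexDel m (ω.getD (m + 1) hvOrigin) (hexIns m x y z ω) = ω := by
  have hlen : (ω.take (m + 1)).length = m + 1 := length_take_succ (by omega)
  have h1 : (hexIns m x y z ω).take (m + 1) = ω.take (m + 1) := by
    rw [hexIns, List.take_left' hlen]
  have h2 : (hexIns m x y z ω).drop (m + 4) = ω.drop (m + 1 + 1) := by
    rw [hexIns, show m + 4 = m + 1 + 3 by omega, ← List.drop_drop, List.drop_left' hlen]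
    rfl
  rw [hexDel, h1, h2, ← List.getElem_eq_getD (h := by omega), ← List.drop_eq_getElem_cons,
    List.take_append_drop]

/-- Re-inserting the deleted vertices. [cite: MadrasSlade1993, §7.3 (proof of Theorem 7.3.2)] -/
theorem hexIns_hexDel (hm : m + 4 ≤ ω.length) :
    hexIns m (ω.getD (m + 1) hvOrigin) (ω.getD (m + 2) hvOrigin) (ω.getD (m + 3) hvOrigin) (hexDel m v ω) = ω := by
  have hlen : (ω.take (m + 1)).length = m + 1 := length_take_succ (by omega)
  have h1 : (hexDel m v ω).take (m + 1) = ω.take (m + 1) := by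
    rw [hexDel, List.take_left' hlen]
  have h2 : (hexDel m v ω).drop (m + 2) = ω.drop (m + 1 + 1 + 1 + 1) := by
    rw [hexDel, show m + 2 = m + 1 + 1 from rfl, ← List.drop_drop, List.drop_left' hlen]
    rfl
  rw [hexIns, h1, h2, ← List.getElem_eq_getD (h := by omega), ← List.getElem_eq_getD (h := by omega),
    ← List.getElem_eq_getD (h := by omega), ← List.drop_eq_getElem_cons, ← List.drop_eq_getElem_cons,
    ← List.drop_eq_getElem_cons, List.take_append_drop]

end Access

/-! ### The surgery maps `S_N`-slots to `S_{N+2}`-deletion sites and back -/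

section Surgery

variable {N : ℕ} {ω : List HV} {m : ℕ} {x y z v : HV}

/-- Hexagon insertion at a slot of an `N`-step self-avoiding walk gives an `(N+2)`-step self-avoiding walk.
[cite: MadrasSlade1993, §7.3 (proof of Theorem 7.3.2)] -/
theorem hexIns_mem_sawFin (hω : ω ∈ sawFin hvOrigin N) (hs : (m, x, y, z) ∈ hexSlots ω) :
    hexIns m x y z ω ∈ sawFin hvOrigin (N + 2) := by
  obtain ⟨hm, hx, hy, hz, hz2, hxω, hyω, hzω, hxz⟩ := mem_hexSlots.1 hs
  have hl := length_of_mem_sawFin hω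
  refine mem_sawFin_of ?_ ?_ ?_ ?_
  · rw [length_hexIns (by omega), hl]
  · rw [getD_hexIns_of_le (by omega) (Nat.zero_le _)]
    exact getD_zero_of_mem_sawFin hω
  · intro i hi
    rcases Nat.lt_or_ge i m with h1 | h1
    · rw [getD_hexIns_of_le (by omega) h1.le, getD_hexIns_of_le (by omega) (by omega)]
      exact adj_getD_of_mem_sawFin hω (by omega)
    rcases Nat.lt_or_ge i (m + 1) with h2 | h2
    · obtain rfl : i = m := by omega
      rw [getD_hexIns_of_le (by omega) le_rfl, getD_hexIns_one (by omega)]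
      exact hx
    rcases Nat.lt_or_ge i (m + 2) with h3 | h3
    · obtain rfl : i = m + 1 := by omega
      rw [getD_hexIns_one (by omega), show m + 1 + 1 = m + 2 from rfl, getD_hexIns_two (by omega)]
      exact hy
    rcases Nat.lt_or_ge i (m + 3) with h4 | h4
    · obtain rfl : i = m + 2 := by omega
      rw [getD_hexIns_two (by omega), show m + 2 + 1 = m + 3 from rfl, getD_hexIns_three (by omega)]
      exact hz
    rcases Nat.lt_or_ge i (m + 4) with h5 | h5
    · obtain rfl : i = m + 3 := by omega
      rw [getD_hexIns_three (by omega), getD_hexIns_of_ge (by omega) (by omega),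
        show m + 3 + 1 - 2 = m + 2 by omega]
      exact hz2
    · rw [getD_hexIns_of_ge (by omega) h5, getD_hexIns_of_ge (by omega) (by omega),
        show i + 1 - 2 = i - 2 + 1 by omega]
      exact adj_getD_of_mem_sawFin hω (by omega)
  · -- self-avoidance
    have hnd := nodup_of_mem_sawFin hω
    have hsplit : ω = ω.take (m + 1) ++ ω.drop (m + 1) := (List.take_append_drop (m + 1) ω).symm
    have hnd' : (ω.take (m + 1) ++ ω.drop (m + 1)).Nodup := hsplit ▸ hnd
    obtain ⟨ht, hd, hdis⟩ := List.nodup_append.1 hnd'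
    have hd2 : (ω.drop (m + 2)).Nodup := by
      rw [show m + 2 = m + 1 + 1 from rfl, ← List.drop_drop]
      exact hd.sublist (List.drop_sublist _ _)
    have hsubD : ∀ b ∈ ω.drop (m + 2), b ∈ ω := fun b hb => List.mem_of_mem_drop hb
    have hsubD' : ∀ b ∈ ω.drop (m + 2), b ∈ ω.drop (m + 1) := fun b hb => by
      rw [show m + 2 = m + 1 + 1 from rfl, ← List.drop_drop] at hb
      exact List.mem_of_mem_drop hb
    have hsubT : ∀ b ∈ ω.take (m + 1), b ∈ ω := fun b hb => List.mem_of_mem_take hb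
    rw [hexIns]
    refine List.nodup_append.2 ⟨ht, ?_, ?_⟩
    · simp only [List.nodup_cons, List.mem_cons, not_or]
      exact ⟨⟨hy.ne, hxz, fun h => hxω (hsubD _ h)⟩, ⟨hz.ne, fun h => hyω (hsubD _ h)⟩,
        fun h => hzω (hsubD _ h), hd2⟩
    · intro b hb c hc
      simp only [List.mem_cons] at hc
      rcases hc with rfl | rfl | rfl | hc
      · exact fun e => hxω (e ▸ hsubT _ hb)
      · exact fun e => hyω (e ▸ hsubT _ hb)
      · exact fun e => hzω (e ▸ hsubT _ hb)
      · exact hdis b hb c (hsubD' _ hc)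

/-- The removed vertex `ω_{m+1}` is not on the new walk. [cite: MadrasSlade1993, §7.3 (proof of Theorem 7.3.2)] -/
theorem getD_succ_not_mem_hexIns (hω : ω ∈ sawFin hvOrigin N) (hs : (m, x, y, z) ∈ hexSlots ω) :
    ω.getD (m + 1) hvOrigin ∉ hexIns m x y z ω := by
  obtain ⟨hm, -, -, -, -, hxω, hyω, hzω, -⟩ := mem_hexSlots.1 hs
  have hl := length_of_mem_sawFin hω
  have hw : ω.getD (m + 1) hvOrigin ∈ ω := getD_mem_of_lt' (by omega)
  intro hmem
  obtain ⟨i, hi, he⟩ := mem_iff_exists_getD.1 hmem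
  rw [length_hexIns (by omega)] at hi
  rcases getD_hexIns_cases (m := m) (x := x) (y := y) (z := z) (by omega) hi with
    ⟨h1, e⟩ | ⟨h1, e⟩ | ⟨h1, e⟩ | ⟨h1, e⟩ | ⟨h1, e⟩ <;> rw [e] at he
  · have := getD_injOn_of_mem_sawFin hω (by omega) (by omega) he; omega
  · exact hxω (he ▸ hw)
  · exact hyω (he ▸ hw)
  · exact hzω (he ▸ hw)
  · have := getD_injOn_of_mem_sawFin hω (by omega) (by omega) he; omega

/-- After the insertion, the removed vertex `ω_{m+1}` marks a deletion site of the new walk.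
[cite: MadrasSlade1993, §7.3 (proof of Theorem 7.3.2)] -/
theorem mem_hexSharp_hexIns (hω : ω ∈ sawFin hvOrigin N) (hs : (m, x, y, z) ∈ hexSlots ω) :
    (m, ω.getD (m + 1) hvOrigin) ∈ hexSharp (hexIns m x y z ω) := by
  obtain ⟨hm, -, -, -, -, -, -, -, -⟩ := mem_hexSlots.1 hs
  have hl := length_of_mem_sawFin hω
  refine mem_hexSharp.2 ⟨by rw [length_hexIns (by omega)]; omega, ?_, ?_, getD_succ_not_mem_hexIns hω hs⟩
  · rw [getD_hexIns_of_le (by omega) le_rfl]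
    exact adj_getD_of_mem_sawFin hω (by omega)
  · rw [getD_hexIns_of_ge (by omega) le_rfl, show m + 4 - 2 = m + 1 + 1 by omega]
    exact adj_getD_of_mem_sawFin hω (by omega)

/-- Hexagon deletion at a deletion site of an `(N+2)`-step self-avoiding walk gives an `N`-step self-avoiding
walk. [cite: MadrasSlade1993, §7.3 (proof of Theorem 7.3.2)] -/
theorem hexDel_mem_sawFin (hω : ω ∈ sawFin hvOrigin (N + 2)) (hm : (m, v) ∈ hexSharp ω) :
    hexDel m v ω ∈ sawFin hvOrigin N := by
  obtain ⟨hml, h1, h2, hv⟩ := mem_hexSharp.1 hm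
  have hl := length_of_mem_sawFin hω
  refine mem_sawFin_of ?_ ?_ ?_ ?_
  · rw [length_hexDel (by omega), hl]
    omega
  · rw [getD_hexDel_of_le (by omega) (Nat.zero_le _)]
    exact getD_zero_of_mem_sawFin hω
  · intro i hi
    rcases Nat.lt_or_ge i m with h3 | h3
    · rw [getD_hexDel_of_le (by omega) h3.le, getD_hexDel_of_le (by omega) (by omega)]
      exact adj_getD_of_mem_sawFin hω (by omega)
    rcases Nat.lt_or_ge i (m + 1) with h4 | h4
    · obtain rfl : i = m := by omega
      rw [getD_hexDel_of_le (by omega) le_rfl, getD_hexDel_one (by omega)]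
      exact h1
    rcases Nat.lt_or_ge i (m + 2) with h5 | h5
    · obtain rfl : i = m + 1 := by omega
      rw [getD_hexDel_one (by omega), getD_hexDel_of_ge (by omega) le_rfl,
        show m + 1 + 1 + 2 = m + 4 by omega]
      exact h2
    · rw [getD_hexDel_of_ge (by omega) h5, getD_hexDel_of_ge (by omega) (by omega),
        show i + 1 + 2 = i + 2 + 1 by omega]
      exact adj_getD_of_mem_sawFin hω (by omega)
  · have hnd := nodup_of_mem_sawFin hω
    have hsplit : ω = ω.take (m + 1) ++ ω.drop (m + 1) := (List.take_append_drop (m + 1) ω).symm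
    have hnd' : (ω.take (m + 1) ++ ω.drop (m + 1)).Nodup := hsplit ▸ hnd
    obtain ⟨ht, hd, hdis⟩ := List.nodup_append.1 hnd'
    have hd4 : (ω.drop (m + 4)).Nodup := by
      rw [show m + 4 = m + 1 + 3 by omega, ← List.drop_drop]
      exact hd.sublist (List.drop_sublist _ _)
    have hsubD : ∀ b ∈ ω.drop (m + 4), b ∈ ω := fun b hb => List.mem_of_mem_drop hb
    have hsubD' : ∀ b ∈ ω.drop (m + 4), b ∈ ω.drop (m + 1) := fun b hb => by
      rw [show m + 4 = m + 1 + 3 by omega, ← List.drop_drop] at hb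
      exact List.mem_of_mem_drop hb
    have hsubT : ∀ b ∈ ω.take (m + 1), b ∈ ω := fun b hb => List.mem_of_mem_take hb
    rw [hexDel]
    refine List.nodup_append.2 ⟨ht, ?_, ?_⟩
    · exact List.nodup_cons.2 ⟨fun h => hv (hsubD _ h), hd4⟩
    · intro b hb c hc
      simp only [List.mem_cons] at hc
      rcases hc with rfl | hc
      · exact fun e => hv (e ▸ hsubT _ hb)
      · exact hdis b hb c (hsubD' _ hc)

/-- After a deletion, the three removed vertices are not on the new walk.
[cite: MadrasSlade1993, §7.3 (proof of Theorem 7.3.2)] -/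
theorem getD_not_mem_hexDel (hω : ω ∈ sawFin hvOrigin (N + 2)) (hm : (m, v) ∈ hexSharp ω) {k : ℕ}
    (hk1 : 1 ≤ k) (hk3 : k ≤ 3) : ω.getD (m + k) hvOrigin ∉ hexDel m v ω := by
  obtain ⟨hml, -, -, hv⟩ := mem_hexSharp.1 hm
  have hl := length_of_mem_sawFin hω
  have hw : ω.getD (m + k) hvOrigin ∈ ω := getD_mem_of_lt' (by omega)
  intro hmem
  obtain ⟨i, hi, he⟩ := mem_iff_exists_getD.1 hmem
  rw [length_hexDel (by omega)] at hi
  rcases getD_hexDel_cases (m := m) (v := v) (by omega) hi with ⟨h1, e⟩ | ⟨h1, e⟩ | ⟨h1, e⟩ <;> rw [e] at he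
  · have := getD_injOn_of_mem_sawFin hω (by omega) (by omega) he; omega
  · exact hv (he ▸ hw)
  · have := getD_injOn_of_mem_sawFin hω (by omega) (by omega) he; omega

/-- After the deletion, the three removed vertices form an insertion slot of the new walk.
[cite: MadrasSlade1993, §7.3 (proof of Theorem 7.3.2)] -/
theorem mem_hexSlots_hexDel (hω : ω ∈ sawFin hvOrigin (N + 2)) (hm : (m, v) ∈ hexSharp ω) :
    (m, ω.getD (m + 1) hvOrigin, ω.getD (m + 2) hvOrigin, ω.getD (m + 3) hvOrigin) ∈ hexSlots (hexDel m v ω) := by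
  obtain ⟨hml, -, -, -⟩ := mem_hexSharp.1 hm
  have hl := length_of_mem_sawFin hω
  refine mem_hexSlots.2 ⟨by rw [length_hexDel (by omega)]; omega, ?_, ?_, ?_, ?_,
    getD_not_mem_hexDel hω hm le_rfl (by norm_num), getD_not_mem_hexDel hω hm (by norm_num) (by norm_num),
    getD_not_mem_hexDel hω hm (by norm_num) le_rfl, ?_⟩
  · rw [getD_hexDel_of_le (by omega) le_rfl]
    exact adj_getD_of_mem_sawFin hω (by omega)
  · exact adj_getD_of_mem_sawFin hω (by omega)
  · exact adj_getD_of_mem_sawFin hω (by omega)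
  · rw [getD_hexDel_of_ge (by omega) le_rfl, show m + 2 + 2 = m + 3 + 1 by omega]
    exact adj_getD_of_mem_sawFin hω (by omega)
  · intro e
    have := getD_injOn_of_mem_sawFin hω (by omega) (by omega) e
    omega

/-- A vertex of `ω` other than `ω_{m+1}` stays on the walk after insertion.
[cite: MadrasSlade1993, §7.3 (proof of Theorem 7.3.2)] -/
theorem mem_hexIns_of_mem (hω : ω ∈ sawFin hvOrigin N) (hm : m + 2 < ω.length) {a : HV} (ha : a ∈ ω)
    (hne : a ≠ ω.getD (m + 1) hvOrigin) : a ∈ hexIns m x y z ω := by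
  have hl := length_of_mem_sawFin hω
  obtain ⟨i, hi, rfl⟩ := mem_iff_exists_getD.1 ha
  rcases Nat.lt_or_ge i (m + 1) with h1 | h1
  · rw [← getD_hexIns_of_le (m := m) (x := x) (y := y) (z := z) (by omega) (by omega : i ≤ m)]
    exact getD_mem_of_lt' (by rw [length_hexIns (by omega)]; omega)
  · have h2 : m + 2 ≤ i := by
      rcases Nat.eq_or_lt_of_le h1 with h | h
      · exact absurd (h ▸ rfl) hne
      · omega
    rw [show i = i + 2 - 2 by omega, ← getD_hexIns_of_ge (m := m) (x := x) (y := y) (z := z) (by omega) (by omega)]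
    exact getD_mem_of_lt' (by rw [length_hexIns (by omega)]; omega)

end Surgery

/-! ### Counting the pairs in two ways -/

section Pairs

/-- The slot pairs `(ω, (m, x, y, z))`, `ω ∈ S_N(ℍ)`, `(m, x, y, z)` an insertion slot of `ω`.
[cite: MadrasSlade1993, §7.3 (proof of Theorem 7.3.2), (7.3.5)] -/
def hexSlotPairs (N : ℕ) : Finset (Σ _ : List HV, ℕ × HV × HV × HV) :=
  (sawFin hvOrigin N).sigma fun ω => hexSlots ω

/-- The deletion-site pairs `(ω, (m, v))`, `ω ∈ S_N(ℍ)`, `(m, v)` a deletion site of `ω`.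
[cite: MadrasSlade1993, §7.3 (proof of Theorem 7.3.2), (7.3.5)] -/
def hexSharpPairs (N : ℕ) : Finset (Σ _ : List HV, ℕ × HV) := (sawFin hvOrigin N).sigma fun ω => hexSharp ω

/-- Summing over slot pairs is summing `I(ω) · F(ω)` over walks. [cite: MadrasSlade1993, §7.3 (proof of Theorem 7.3.2)] -/
theorem sum_hexSlotPairs (N : ℕ) (F : List HV → ℝ) :
    ∑ p ∈ hexSlotPairs N, F p.1 = ∑ ω ∈ sawFin hvOrigin N, (#(hexSlots ω) : ℝ) * F ω := by
  rw [hexSlotPairs, Finset.sum_sigma]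
  refine sum_congr rfl fun ω _ => ?_
  change ∑ s ∈ hexSlots ω, F ω = _
  rw [sum_const, nsmul_eq_mul]

/-- Summing over deletion-site pairs is summing `J(ω) · F(ω)` over walks.
[cite: MadrasSlade1993, §7.3 (proof of Theorem 7.3.2)] -/
theorem sum_hexSharpPairs (N : ℕ) (F : List HV → ℝ) :
    ∑ q ∈ hexSharpPairs N, F q.1 = ∑ ω ∈ sawFin hvOrigin N, (#(hexSharp ω) : ℝ) * F ω := by
  rw [hexSharpPairs, Finset.sum_sigma]
  refine sum_congr rfl fun ω _ => ?_
  change ∑ s ∈ hexSharp ω, F ω = _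
  rw [sum_const, nsmul_eq_mul]

/-- **Counting the allowed pairs in two ways**: `(ω, (m, x, y, z)) ↦ (hexIns m x y z ω, (m, ω_{m+1}))` is a
bijection from the slot pairs of `S_N(ℍ)` onto the deletion-site pairs of `S_{N+2}(ℍ)` (inverse
`(ω', (m, v)) ↦ (hexDel m v ω', (m, ω'_{m+1}, ω'_{m+2}, ω'_{m+3}))`).
[cite: MadrasSlade1993, §7.3 (proof of Theorem 7.3.2), (7.3.5)–(7.3.6)] -/
theorem sum_hexSlotPairs_eq_sum_hexSharpPairs (N : ℕ) (F : (Σ _ : List HV, ℕ × HV × HV × HV) → ℝ)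
    (G : (Σ _ : List HV, ℕ × HV) → ℝ)
    (h : ∀ p ∈ hexSlotPairs N,
      F p = G ⟨hexIns p.2.1 p.2.2.1 p.2.2.2.1 p.2.2.2.2 p.1, (p.2.1, p.1.getD (p.2.1 + 1) hvOrigin)⟩) :
    ∑ p ∈ hexSlotPairs N, F p = ∑ q ∈ hexSharpPairs (N + 2), G q := by
  refine Finset.sum_nbij' (fun p => ⟨hexIns p.2.1 p.2.2.1 p.2.2.2.1 p.2.2.2.2 p.1, (p.2.1, p.1.getD (p.2.1 + 1) hvOrigin)⟩)
    (fun q => ⟨hexDel q.2.1 q.2.2 q.1,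
      (q.2.1, q.1.getD (q.2.1 + 1) hvOrigin, q.1.getD (q.2.1 + 2) hvOrigin, q.1.getD (q.2.1 + 3) hvOrigin)⟩)
    ?_ ?_ ?_ ?_ h
  · rintro ⟨ω, m, x, y, z⟩ hp
    rw [hexSlotPairs, Finset.mem_sigma] at hp
    rw [hexSharpPairs, Finset.mem_sigma]
    exact ⟨hexIns_mem_sawFin hp.1 hp.2, mem_hexSharp_hexIns hp.1 hp.2⟩
  · rintro ⟨ω, m, v⟩ hq
    rw [hexSharpPairs, Finset.mem_sigma] at hq
    rw [hexSlotPairs, Finset.mem_sigma]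
    exact ⟨hexDel_mem_sawFin hq.1 hq.2, mem_hexSlots_hexDel hq.1 hq.2⟩
  · rintro ⟨ω, m, x, y, z⟩ hp
    rw [hexSlotPairs, Finset.mem_sigma] at hp
    dsimp only at hp
    obtain ⟨hm, -⟩ := mem_hexSlots.1 hp.2
    dsimp only
    rw [hexDel_hexIns (by omega), getD_hexIns_one (by omega), getD_hexIns_two (by omega),
      getD_hexIns_three (by omega)]
  · rintro ⟨ω, m, v⟩ hq
    rw [hexSharpPairs, Finset.mem_sigma] at hq
    dsimp only at hq
    obtain ⟨hml, -⟩ := mem_hexSharp.1 hq.2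
    dsimp only
    rw [hexIns_hexDel (by omega), getD_hexDel_one (by omega)]

end Pairs

/-! ### Bookkeeping: how the surgeries change `I` and `J` -/

section Bookkeeping

variable {N : ℕ} {ω : List HV} {m : ℕ} {x y z : HV}

/-- After an insertion the new walk has a deletion site: `1 ≤ J(ω')`.
[cite: MadrasSlade1993, §7.3 (proof of Theorem 7.3.2)] -/
theorem one_le_card_hexSharp_hexIns (hω : ω ∈ sawFin hvOrigin N) (hs : (m, x, y, z) ∈ hexSlots ω) :
    1 ≤ #(hexSharp (hexIns m x y z ω)) :=
  card_pos.2 ⟨_, mem_hexSharp_hexIns hω hs⟩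

/-- The positions at which the walk visits a neighbour of `t`: at most `3`. [folklore] -/
private theorem card_filter_getD_adj_le (hω : ω ∈ sawFin hvOrigin N) (t : HV) :
    #((range (N + 1)).filter fun i => hvGraph.Adj t (ω.getD i hvOrigin)) ≤ 3 := by
  refine le_trans ?_ (card_hexNb_le t)
  refine card_le_card_of_injOn (fun i => ω.getD i hvOrigin) (fun i hi => ?_) (fun i hi j hj e => ?_)
  · rw [mem_coe, mem_filter] at hi
    rw [mem_coe, mem_hexNb]
    exact hi.2
  · rw [mem_coe, mem_filter, mem_range] at hi hj
    exact getD_injOn_of_mem_sawFin hω hi.1 hj.1 e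

/-- Deletion sites at a fixed position: at most `3`. [folklore] -/
private theorem card_hexSharp_filter_fst_eq_le (ω : List HV) (j : ℕ) :
    #((hexSharp ω).filter fun p => p.1 = j) ≤ 3 := by
  refine le_trans (card_le_card (t := (hexNb (ω.getD j hvOrigin)).image fun v => (j, v)) ?_)
    (card_image_le.trans (card_hexNb_le (ω.getD j hvOrigin)))
  rintro ⟨j', v⟩ hp
  rw [mem_filter] at hp
  obtain ⟨hp, rfl⟩ := hp
  obtain ⟨-, h1, -, -⟩ := mem_hexSharp.1 hp
  exact mem_image.2 ⟨v, mem_hexNb.2 h1, rfl⟩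

/-- Deletion sites at positions in a window `[a, b]`: at most `3 (b + 1 − a)`. [folklore] -/
private theorem card_hexSharp_filter_fst_mem_Icc_le (ω : List HV) (a b : ℕ) :
    #((hexSharp ω).filter fun p => a ≤ p.1 ∧ p.1 ≤ b) ≤ 3 * (b + 1 - a) := by
  have hsub : ((hexSharp ω).filter fun p => a ≤ p.1 ∧ p.1 ≤ b) ⊆
      (Icc a b).biUnion fun j => (hexSharp ω).filter fun p => p.1 = j := by
    intro p hp
    rw [mem_filter] at hp
    exact mem_biUnion.2 ⟨p.1, mem_Icc.2 hp.2, mem_filter.2 ⟨hp.1, rfl⟩⟩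
  refine (card_le_card hsub).trans (card_biUnion_le.trans ?_)
  calc ∑ j ∈ Icc a b, #((hexSharp ω).filter fun p => p.1 = j) ≤ ∑ _j ∈ Icc a b, 3 :=
        sum_le_sum fun j _ => card_hexSharp_filter_fst_eq_le ω j
    _ = 3 * (b + 1 - a) := by rw [sum_const, Nat.card_Icc, smul_eq_mul, mul_comm]

/-- Deletion sites with a fixed free vertex: at most `3` (the walk visits each neighbour of the vertex at most
once). [folklore] -/
private theorem card_hexSharp_filter_snd_eq_le (hω : ω ∈ sawFin hvOrigin N) (t : HV) :
    #((hexSharp ω).filter fun p => p.2 = t) ≤ 3 := by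
  have hl := length_of_mem_sawFin hω
  refine le_trans (card_le_card (t := ((range (N + 1)).filter fun i =>
      hvGraph.Adj t (ω.getD i hvOrigin)).image fun i => (i, t)) ?_)
    (card_image_le.trans (card_filter_getD_adj_le hω t))
  rintro ⟨i, v⟩ hp
  rw [mem_filter] at hp
  obtain ⟨hp, rfl⟩ := hp
  obtain ⟨hi, h1, -, -⟩ := mem_hexSharp.1 hp
  exact mem_image.2 ⟨i, mem_filter.2 ⟨mem_range.2 (by omega), h1.symm⟩, rfl⟩

/-- `J(ω) ≤ J(ω') + 24`: a deletion site `(j, v)` of `ω` with `j ∉ [m−3, m+1]` and `v ∉ {x, y, z}` is (shifted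
by `2` if `j ≥ m + 2`) a deletion site of `hexIns m x y z ω`.
[cite: MadrasSlade1993, §7.3 (proof of Theorem 7.3.2), p. 245] -/
theorem card_hexSharp_le_hexIns (hω : ω ∈ sawFin hvOrigin N) (hs : (m, x, y, z) ∈ hexSlots ω) :
    #(hexSharp ω) ≤ #(hexSharp (hexIns m x y z ω)) + 24 := by
  obtain ⟨hm, -, -, -, -, hxω, hyω, hzω, -⟩ := mem_hexSlots.1 hs
  have hl := length_of_mem_sawFin hω
  set E := (hexSharp ω).filter fun p => (m ≤ p.1 + 3 ∧ p.1 ≤ m + 1) ∨ (p.2 = x ∨ p.2 = y ∨ p.2 = z) with hE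
  set K := (hexSharp ω).filter fun p => ¬((m ≤ p.1 + 3 ∧ p.1 ≤ m + 1) ∨ (p.2 = x ∨ p.2 = y ∨ p.2 = z))
    with hK
  have hsplit : #(hexSharp ω) = #E + #K := (card_filter_add_card_filter_not _).symm
  -- the exceptional sites
  have hE' : #E ≤ 24 := by
    have hsub : E ⊆ ((hexSharp ω).filter fun p => m - 3 ≤ p.1 ∧ p.1 ≤ m + 1) ∪
        (((hexSharp ω).filter fun p => p.2 = x) ∪ (((hexSharp ω).filter fun p => p.2 = y) ∪
          ((hexSharp ω).filter fun p => p.2 = z))) := by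
      intro p hp
      rw [hE, mem_filter] at hp
      simp only [mem_union, mem_filter]
      rcases hp.2 with h | h | h | h
      · exact Or.inl ⟨hp.1, by omega, h.2⟩
      · exact Or.inr (Or.inl ⟨hp.1, h⟩)
      · exact Or.inr (Or.inr (Or.inl ⟨hp.1, h⟩))
      · exact Or.inr (Or.inr (Or.inr ⟨hp.1, h⟩))
    refine (card_le_card hsub).trans ?_
    refine (card_union_le _ _).trans ?_
    have h1 := card_hexSharp_filter_fst_mem_Icc_le ω (m - 3) (m + 1)
    have h2 := card_hexSharp_filter_snd_eq_le hω x
    have h3 := card_hexSharp_filter_snd_eq_le hω y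
    have h4 := card_hexSharp_filter_snd_eq_le hω z
    have h5 := card_union_le ((hexSharp ω).filter fun p => p.2 = x)
      (((hexSharp ω).filter fun p => p.2 = y) ∪ ((hexSharp ω).filter fun p => p.2 = z))
    have h6 := card_union_le ((hexSharp ω).filter fun p => p.2 = y) ((hexSharp ω).filter fun p => p.2 = z)
    omega
  -- the surviving sites inject into the deletion sites of the new walk
  have hK' : #K ≤ #(hexSharp (hexIns m x y z ω)) := by
    refine card_le_card_of_injOn (fun p => (if p.1 + 4 ≤ m then p.1 else p.1 + 2, p.2)) ?_ ?_
    · rintro ⟨j, v⟩ hp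
      rw [mem_coe, hK, mem_filter] at hp
      obtain ⟨hp, hne⟩ := hp
      simp only [not_or] at hne
      obtain ⟨hne1, hvx, hvy, hvz⟩ := hne
      obtain ⟨hj, ha1, ha2, hv⟩ := mem_hexSharp.1 hp
      have hv' : v ∉ hexIns m x y z ω := fun h => by
        rcases mem_hexIns h with e | e | e | e
        · exact hvx e
        · exact hvy e
        · exact hvz e
        · exact hv e
      rw [mem_coe]
      dsimp only
      split_ifs with hjm
      · refine mem_hexSharp.2 ⟨by rw [length_hexIns (by omega)]; omega, ?_, ?_, hv'⟩
        · rwa [getD_hexIns_of_le (by omega) (by omega)]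
        · rwa [getD_hexIns_of_le (by omega) hjm]
      · have hj2 : m + 2 ≤ j := by omega
        refine mem_hexSharp.2 ⟨by rw [length_hexIns (by omega)]; omega, ?_, ?_, hv'⟩
        · rwa [getD_hexIns_of_ge (by omega) (by omega), show j + 2 - 2 = j by omega]
        · rwa [getD_hexIns_of_ge (by omega) (by omega), show j + 2 + 4 - 2 = j + 4 by omega]
    · rintro ⟨j, v⟩ - ⟨j', v'⟩ - e
      simp only [Prod.mk.injEq] at e
      obtain ⟨e1, rfl⟩ := e
      have : j = j' := by split_ifs at e1 <;> omega
      rw [this]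
  omega

/-- `J(ω') ≤ J(ω) + 24`: a deletion site `(j', v')` of `hexIns m x y z ω` with `j' ∉ [m−3, m+3]` and
`v' ≠ ω_{m+1}` is (shifted back) a deletion site of `ω`.
[cite: MadrasSlade1993, §7.3 (proof of Theorem 7.3.2), p. 245] -/
theorem card_hexSharp_hexIns_le (hω : ω ∈ sawFin hvOrigin N) (hs : (m, x, y, z) ∈ hexSlots ω) :
    #(hexSharp (hexIns m x y z ω)) ≤ #(hexSharp ω) + 24 := by
  obtain ⟨hm, -, -, -, -, -, -, -, -⟩ := mem_hexSlots.1 hs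
  have hl := length_of_mem_sawFin hω
  have hω' := hexIns_mem_sawFin hω hs
  set ω' := hexIns m x y z ω with hω'def
  set w := ω.getD (m + 1) hvOrigin with hw
  set E := (hexSharp ω').filter fun p => (m ≤ p.1 + 3 ∧ p.1 ≤ m + 3) ∨ p.2 = w with hE
  set K := (hexSharp ω').filter fun p => ¬((m ≤ p.1 + 3 ∧ p.1 ≤ m + 3) ∨ p.2 = w) with hK
  have hsplit : #(hexSharp ω') = #E + #K := (card_filter_add_card_filter_not _).symm
  have hE' : #E ≤ 24 := by
    have hsub : E ⊆ ((hexSharp ω').filter fun p => m - 3 ≤ p.1 ∧ p.1 ≤ m + 3) ∪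
        ((hexSharp ω').filter fun p => p.2 = w) := by
      intro p hp
      rw [hE, mem_filter] at hp
      simp only [mem_union, mem_filter]
      rcases hp.2 with h | h
      · exact Or.inl ⟨hp.1, by omega, h.2⟩
      · exact Or.inr ⟨hp.1, h⟩
    refine (card_le_card hsub).trans ((card_union_le _ _).trans ?_)
    have h1 := card_hexSharp_filter_fst_mem_Icc_le ω' (m - 3) (m + 3)
    have h2 := card_hexSharp_filter_snd_eq_le hω' w
    omega
  have hK' : #K ≤ #(hexSharp ω) := by
    refine card_le_card_of_injOn (fun p => (if p.1 + 4 ≤ m then p.1 else p.1 - 2, p.2)) ?_ ?_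
    · rintro ⟨j, v⟩ hp
      rw [mem_coe, hK, mem_filter] at hp
      obtain ⟨hp, hne⟩ := hp
      simp only [not_or] at hne
      obtain ⟨hne1, hvw⟩ := hne
      obtain ⟨hj, ha1, ha2, hv⟩ := mem_hexSharp.1 hp
      rw [hω'def, length_hexIns (by omega)] at hj
      have hv' : v ∉ ω := fun h => hv (mem_hexIns_of_mem hω hm h hvw)
      rw [mem_coe]
      dsimp only
      split_ifs with hjm
      · refine mem_hexSharp.2 ⟨by omega, ?_, ?_, hv'⟩
        · rwa [hω'def, getD_hexIns_of_le (by omega) (by omega)] at ha1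
        · rwa [hω'def, getD_hexIns_of_le (by omega) hjm] at ha2
      · have hj2 : m + 4 ≤ j := by omega
        refine mem_hexSharp.2 ⟨by omega, ?_, ?_, hv'⟩
        · rwa [hω'def, getD_hexIns_of_ge (by omega) hj2] at ha1
        · rwa [hω'def, getD_hexIns_of_ge (by omega) (by omega), show j + 4 - 2 = j - 2 + 4 by omega] at ha2
    · rintro ⟨j, v⟩ hj ⟨j', v'⟩ hj' e
      rw [mem_coe, hK, mem_filter] at hj hj'
      simp only [not_or] at hj hj'
      simp only [Prod.mk.injEq] at e
      obtain ⟨e1, rfl⟩ := e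
      have : j = j' := by split_ifs at e1 <;> omega
      rw [this]
  omega

/-- Slots at a fixed position: at most `27`. [folklore] -/
private theorem card_hexSlots_filter_fst_eq_le (ω : List HV) (j : ℕ) :
    #((hexSlots ω).filter fun s => s.1 = j) ≤ 27 := by
  refine le_trans (card_le_card (t := (hexChain3 (ω.getD j hvOrigin)).image fun c => (j, c)) ?_)
    (card_image_le.trans (card_hexChain3_le (ω.getD j hvOrigin)))
  rintro ⟨j', x', y', z'⟩ hp
  rw [mem_filter] at hp
  obtain ⟨hp, rfl⟩ := hp
  obtain ⟨-, h1, h2, h3, -⟩ := mem_hexSlots.1 hp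
  exact mem_image.2 ⟨(x', y', z'), mem_hexChain3.2 ⟨h1, h2, h3⟩, rfl⟩

/-- Slots at positions in a window `[a, b]`: at most `27 (b + 1 − a)`. [folklore] -/
private theorem card_hexSlots_filter_fst_mem_Icc_le (ω : List HV) (a b : ℕ) :
    #((hexSlots ω).filter fun s => a ≤ s.1 ∧ s.1 ≤ b) ≤ 27 * (b + 1 - a) := by
  have hsub : ((hexSlots ω).filter fun s => a ≤ s.1 ∧ s.1 ≤ b) ⊆
      (Icc a b).biUnion fun j => (hexSlots ω).filter fun s => s.1 = j := by
    intro p hp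
    rw [mem_filter] at hp
    exact mem_biUnion.2 ⟨p.1, mem_Icc.2 hp.2, mem_filter.2 ⟨hp.1, rfl⟩⟩
  refine (card_le_card hsub).trans (card_biUnion_le.trans ?_)
  calc ∑ j ∈ Icc a b, #((hexSlots ω).filter fun s => s.1 = j) ≤ ∑ _j ∈ Icc a b, 27 :=
        sum_le_sum fun j _ => card_hexSlots_filter_fst_eq_le ω j
    _ = 27 * (b + 1 - a) := by rw [sum_const, Nat.card_Icc, smul_eq_mul, mul_comm]

/-- Slots whose first new vertex is `t`: at most `27`. [folklore] -/
private theorem card_hexSlots_filter_x_eq_le (hω : ω ∈ sawFin hvOrigin N) (t : HV) :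
    #((hexSlots ω).filter fun s => s.2.1 = t) ≤ 27 := by
  have hl := length_of_mem_sawFin hω
  set P := (range (N + 1)).filter fun i => hvGraph.Adj t (ω.getD i hvOrigin) with hP
  set T := (P ×ˢ ((hexNb t).biUnion fun y' => (hexNb y').image fun z' => (y', z'))).image
    fun q : ℕ × HV × HV => (q.1, t, q.2.1, q.2.2) with hT
  have hsub : ((hexSlots ω).filter fun s => s.2.1 = t) ⊆ T := by
    rintro ⟨i, x', y', z'⟩ hs
    rw [mem_filter] at hs
    obtain ⟨hs, rfl⟩ := hs
    obtain ⟨hi, h1, h2, h3, -⟩ := mem_hexSlots.1 hs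
    rw [hT, mem_image]
    refine ⟨(i, y', z'), mem_product.2 ⟨mem_filter.2 ⟨mem_range.2 (by omega), h1.symm⟩,
      mem_biUnion.2 ⟨y', mem_hexNb.2 h2, mem_image.2 ⟨z', mem_hexNb.2 h3, rfl⟩⟩⟩, rfl⟩
  refine (card_le_card hsub).trans (card_image_le.trans ?_)
  rw [card_product]
  have hP3 : #P ≤ 3 := card_filter_getD_adj_le hω t
  have h9 : #((hexNb t).biUnion fun y' => (hexNb y').image fun z' => (y', z')) ≤ 9 := by
    refine card_biUnion_le.trans ?_
    calc ∑ y' ∈ hexNb t, #((hexNb y').image fun z' => (y', z')) ≤ ∑ _y' ∈ hexNb t, 3 :=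
          sum_le_sum fun y' _ => card_image_le.trans (card_hexNb_le y')
      _ ≤ 9 := by rw [sum_const, smul_eq_mul]; have := card_hexNb_le t; omega
  calc #P * #((hexNb t).biUnion fun y' => (hexNb y').image fun z' => (y', z')) ≤ 3 * 9 :=
        Nat.mul_le_mul hP3 h9
    _ = 27 := by norm_num

/-- Slots whose middle new vertex is `t`: at most `27`. [folklore] -/
private theorem card_hexSlots_filter_y_eq_le (hω : ω ∈ sawFin hvOrigin N) (t : HV) :
    #((hexSlots ω).filter fun s => s.2.2.1 = t) ≤ 27 := by
  have hl := length_of_mem_sawFin hω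
  set P : HV → Finset ℕ := fun x' => (range (N + 1)).filter fun i => hvGraph.Adj x' (ω.getD i hvOrigin) with hP
  set T := (((hexNb t).biUnion fun x' => (P x').image fun i => (i, x')) ×ˢ hexNb t).image
    fun q : (ℕ × HV) × HV => (q.1.1, q.1.2, t, q.2) with hT
  have hsub : ((hexSlots ω).filter fun s => s.2.2.1 = t) ⊆ T := by
    rintro ⟨i, x', y', z'⟩ hs
    rw [mem_filter] at hs
    obtain ⟨hs, rfl⟩ := hs
    obtain ⟨hi, h1, h2, h3, -⟩ := mem_hexSlots.1 hs
    rw [hT, mem_image]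
    refine ⟨((i, x'), z'), mem_product.2 ⟨mem_biUnion.2 ⟨x', mem_hexNb.2 h2.symm,
      mem_image.2 ⟨i, mem_filter.2 ⟨mem_range.2 (by omega), h1.symm⟩, rfl⟩⟩, mem_hexNb.2 h3⟩, rfl⟩
  refine (card_le_card hsub).trans (card_image_le.trans ?_)
  rw [card_product]
  have h9 : #((hexNb t).biUnion fun x' => (P x').image fun i => (i, x')) ≤ 9 := by
    refine card_biUnion_le.trans ?_
    calc ∑ x' ∈ hexNb t, #((P x').image fun i => (i, x')) ≤ ∑ _x' ∈ hexNb t, 3 :=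
          sum_le_sum fun x' _ => card_image_le.trans (card_filter_getD_adj_le hω x')
      _ ≤ 9 := by rw [sum_const, smul_eq_mul]; have := card_hexNb_le t; omega
  calc #((hexNb t).biUnion fun x' => (P x').image fun i => (i, x')) * #(hexNb t) ≤ 9 * 3 :=
        Nat.mul_le_mul h9 (card_hexNb_le t)
    _ = 27 := by norm_num

/-- Slots whose last new vertex is `t`: at most `27`. [folklore] -/
private theorem card_hexSlots_filter_z_eq_le (hω : ω ∈ sawFin hvOrigin N) (t : HV) :
    #((hexSlots ω).filter fun s => s.2.2.2 = t) ≤ 27 := by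
  have hl := length_of_mem_sawFin hω
  set P : HV → Finset ℕ := fun x' => (range (N + 1)).filter fun i => hvGraph.Adj x' (ω.getD i hvOrigin) with hP
  set T := ((hexNb t).biUnion fun y' => (hexNb y').biUnion fun x' => (P x').image fun i => (i, x', y', t))
    with hT
  have hsub : ((hexSlots ω).filter fun s => s.2.2.2 = t) ⊆ T := by
    rintro ⟨i, x', y', z'⟩ hs
    rw [mem_filter] at hs
    obtain ⟨hs, rfl⟩ := hs
    obtain ⟨hi, h1, h2, h3, -⟩ := mem_hexSlots.1 hs
    rw [hT]
    exact mem_biUnion.2 ⟨y', mem_hexNb.2 h3.symm, mem_biUnion.2 ⟨x', mem_hexNb.2 h2.symm,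
      mem_image.2 ⟨i, mem_filter.2 ⟨mem_range.2 (by omega), h1.symm⟩, rfl⟩⟩⟩
  refine (card_le_card hsub).trans (card_biUnion_le.trans ?_)
  calc ∑ y' ∈ hexNb t, #((hexNb y').biUnion fun x' => (P x').image fun i => (i, x', y', t))
      ≤ ∑ _y' ∈ hexNb t, 9 := by
        refine sum_le_sum fun y' _ => card_biUnion_le.trans ?_
        calc ∑ x' ∈ hexNb y', #((P x').image fun i => (i, x', y', t)) ≤ ∑ _x' ∈ hexNb y', 3 :=
              sum_le_sum fun x' _ => card_image_le.trans (card_filter_getD_adj_le hω x')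
          _ ≤ 9 := by rw [sum_const, smul_eq_mul]; have := card_hexNb_le y'; omega
    _ ≤ 27 := by rw [sum_const, smul_eq_mul]; have := card_hexNb_le t; omega

/-- Slots through a fixed vertex: at most `81`. [folklore] -/
private theorem card_hexSlots_filter_mem_le (hω : ω ∈ sawFin hvOrigin N) (t : HV) :
    #((hexSlots ω).filter fun s => s.2.1 = t ∨ s.2.2.1 = t ∨ s.2.2.2 = t) ≤ 81 := by
  rw [filter_or, filter_or]
  have h1 := card_hexSlots_filter_x_eq_le hω t
  have h2 := card_hexSlots_filter_y_eq_le hω t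
  have h3 := card_hexSlots_filter_z_eq_le hω t
  have h4 := card_union_le ((hexSlots ω).filter fun s => s.2.2.1 = t) ((hexSlots ω).filter fun s => s.2.2.2 = t)
  have h5 := card_union_le ((hexSlots ω).filter fun s => s.2.1 = t)
    (((hexSlots ω).filter fun s => s.2.2.1 = t) ∪ ((hexSlots ω).filter fun s => s.2.2.2 = t))
  omega

/-- `I(ω) ≤ I(ω') + 324`: a slot `(j, x', y', z')` of `ω` with `j ∉ {m−1, m, m+1}` and `{x', y', z'}` disjoint
from `{x, y, z}` is (shifted by `2` if `j ≥ m + 2`) a slot of `hexIns m x y z ω`.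
[cite: MadrasSlade1993, §7.3 (proof of Theorem 7.3.2), p. 245] -/
theorem card_hexSlots_le_hexIns (hω : ω ∈ sawFin hvOrigin N) (hs : (m, x, y, z) ∈ hexSlots ω) :
    #(hexSlots ω) ≤ #(hexSlots (hexIns m x y z ω)) + 324 := by
  obtain ⟨hm, -, -, -, -, hxω, hyω, hzω, -⟩ := mem_hexSlots.1 hs
  have hl := length_of_mem_sawFin hω
  let bad : ℕ × HV × HV × HV → Prop := fun s => (m ≤ s.1 + 1 ∧ s.1 ≤ m + 1) ∨
    ((s.2.1 = x ∨ s.2.2.1 = x ∨ s.2.2.2 = x) ∨ (s.2.1 = y ∨ s.2.2.1 = y ∨ s.2.2.2 = y) ∨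
      (s.2.1 = z ∨ s.2.2.1 = z ∨ s.2.2.2 = z))
  set E := (hexSlots ω).filter fun s => bad s with hE
  set K := (hexSlots ω).filter fun s => ¬ bad s with hK
  have hsplit : #(hexSlots ω) = #E + #K := (card_filter_add_card_filter_not _).symm
  have hE' : #E ≤ 324 := by
    have hsub : E ⊆ ((hexSlots ω).filter fun s => m - 1 ≤ s.1 ∧ s.1 ≤ m + 1) ∪
        (((hexSlots ω).filter fun s => s.2.1 = x ∨ s.2.2.1 = x ∨ s.2.2.2 = x) ∪
          (((hexSlots ω).filter fun s => s.2.1 = y ∨ s.2.2.1 = y ∨ s.2.2.2 = y) ∪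
            ((hexSlots ω).filter fun s => s.2.1 = z ∨ s.2.2.1 = z ∨ s.2.2.2 = z))) := by
      intro p hp
      rw [hE, mem_filter] at hp
      simp only [mem_union, mem_filter]
      rcases hp.2 with h | h | h | h
      · exact Or.inl ⟨hp.1, by omega, h.2⟩
      · exact Or.inr (Or.inl ⟨hp.1, h⟩)
      · exact Or.inr (Or.inr (Or.inl ⟨hp.1, h⟩))
      · exact Or.inr (Or.inr (Or.inr ⟨hp.1, h⟩))
    refine (card_le_card hsub).trans ((card_union_le _ _).trans ?_)
    have h1 := card_hexSlots_filter_fst_mem_Icc_le ω (m - 1) (m + 1)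
    have h2 := card_hexSlots_filter_mem_le hω x
    have h3 := card_hexSlots_filter_mem_le hω y
    have h4 := card_hexSlots_filter_mem_le hω z
    have h5 := card_union_le ((hexSlots ω).filter fun s => s.2.1 = x ∨ s.2.2.1 = x ∨ s.2.2.2 = x)
      (((hexSlots ω).filter fun s => s.2.1 = y ∨ s.2.2.1 = y ∨ s.2.2.2 = y) ∪
        ((hexSlots ω).filter fun s => s.2.1 = z ∨ s.2.2.1 = z ∨ s.2.2.2 = z))
    have h6 := card_union_le ((hexSlots ω).filter fun s => s.2.1 = y ∨ s.2.2.1 = y ∨ s.2.2.2 = y)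
      ((hexSlots ω).filter fun s => s.2.1 = z ∨ s.2.2.1 = z ∨ s.2.2.2 = z)
    omega
  have hK' : #K ≤ #(hexSlots (hexIns m x y z ω)) := by
    refine card_le_card_of_injOn (fun s => (if s.1 + 2 ≤ m then s.1 else s.1 + 2, s.2)) ?_ ?_
    · rintro ⟨j, x', y', z'⟩ hp
      rw [mem_coe, hK, mem_filter] at hp
      obtain ⟨hp, hne⟩ := hp
      simp only [bad, not_or] at hne
      obtain ⟨hne1, ⟨hx1, hx2, hx3⟩, ⟨hy1, hy2, hy3⟩, ⟨hz1, hz2, hz3⟩⟩ := hne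
      obtain ⟨hj, ha1, ha2, ha3, ha4, hx', hy', hz', hxz'⟩ := mem_hexSlots.1 hp
      have hnot : ∀ {a : HV}, a ∉ ω → a ≠ x → a ≠ y → a ≠ z → a ∉ hexIns m x y z ω :=
        fun ha hax hay haz h => by
          rcases mem_hexIns h with e | e | e | e
          · exact hax e
          · exact hay e
          · exact haz e
          · exact ha e
      rw [mem_coe]
      dsimp only
      split_ifs with hjm
      · refine mem_hexSlots.2 ⟨by rw [length_hexIns (by omega)]; omega, ?_, ha2, ha3, ?_,
          hnot hx' hx1 hy1 hz1, hnot hy' hx2 hy2 hz2, hnot hz' hx3 hy3 hz3, hxz'⟩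
        · rwa [getD_hexIns_of_le (by omega) (by omega)]
        · rwa [getD_hexIns_of_le (by omega) hjm]
      · have hj2 : m + 2 ≤ j := by omega
        refine mem_hexSlots.2 ⟨by rw [length_hexIns (by omega)]; omega, ?_, ha2, ha3, ?_,
          hnot hx' hx1 hy1 hz1, hnot hy' hx2 hy2 hz2, hnot hz' hx3 hy3 hz3, hxz'⟩
        · rwa [getD_hexIns_of_ge (by omega) (by omega), show j + 2 - 2 = j by omega]
        · rwa [getD_hexIns_of_ge (by omega) (by omega), show j + 2 + 2 - 2 = j + 2 by omega]
    · rintro ⟨j, c⟩ - ⟨j', c'⟩ - e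
      simp only [Prod.mk.injEq] at e
      obtain ⟨e1, rfl⟩ := e
      have : j = j' := by split_ifs at e1 <;> omega
      rw [this]
  omega

end Bookkeeping

/-! ### The faces of the bet «HEX-RATIO-2» (statement shapes) -/

section Faces

/-- **Density of deletion sites** (entropy input of Kesten's argument on `ℍ`, exponential form): all but
`C 2^{-⌊N/Q⌋} √(2+√2)^N` of the `N`-step self-avoiding walks on `ℍ` have more than `N/(4Q)` deletion sites.
A hypothesis schema (proved in the lane's K1′-ℍ file from the run structure of the turn word).
[cite: MadrasSlade1993, Lemma 7.2.5 and Theorem 7.2.3 (the pattern-theorem input, here pattern-free)] -/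
def DetourDensityHex : Prop :=
  ∃ Q : ℕ, 0 < Q ∧ ∃ C : ℝ, ∀ N : ℕ,
    (({l : List HV | l ∈ sawLists hvGraph hvOrigin N ∧ #(hexSharp l) ≤ N / (4 * Q)}.ncard : ℕ) : ℝ) ≤
      C * (1 / 2 : ℝ) ^ (N / Q) * Real.sqrt (2 + Real.sqrt 2) ^ N

/-- **Kesten's ratio inequality with step two on `ℍ`**: `φ_N² − D/N ≤ φ_N φ_{N+2}` eventually,
`φ_N = c_{N+2}(ℍ)/c_N(ℍ)` — hypothesis (7.3.4) of Madras–Slade Lemma 7.3.1 (= `hiii` of the tree's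
`Zd.tendsto_ratio_of_kesten` with `a = hexSawCount`). A statement schema (proved from the transfer counts).
[cite: MadrasSlade1993, Lemma 7.3.1 (7.3.4) and Theorem 7.3.4(a)] -/
def KestenIneqHex : Prop :=
  ∃ D : ℝ, ∀ᶠ N : ℕ in atTop,
    ((hexSawCount (N + 2) : ℝ) / hexSawCount N) ^ 2 - D / N ≤
      ((hexSawCount (N + 2) : ℝ) / hexSawCount N) * ((hexSawCount (N + 4) : ℝ) / hexSawCount (N + 2))

end Faces

end Literature.Probability.RandomPlanarGeometry.SAW.HV
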